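import Mathlib
import HarnessLib
import Literature.Analysis.Calculus.SmoothArzelaAscoli
import Literature.Analysis.Calculus.CkArzelaAscoli

/-!
# Item `LrcModEntire` (stmt-NavierStokesRegularity-20428) — (Q3) GENERIC HULL-HOMOGENISATION TOOLKIT for the «ridge quasiconvexity» lever

ns-k2-port-2 g5 (helper prover under the LEAD of item 20428, ns-poloidal-K2-p3 g14; `--supports stmt-NavierStokesRegularity-20428 --as helper`).
Memo `Cruxes/LrcModEntire/T2B-g14.md` §9 (Q3) / §10 «HULL STATEMENT»: a bounded quasiconvex (or monotone) translation-covariant ridge functional `φ` along an unbounded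
hot branch converges, `φ(s) → φ_∞`, and along every hull limit `U` of the re-pinned translates `v(·, · + γ(s_k))`, `s_k → ∞` (tree: `…HotHullCompactness.hullLimit`,
slices converging LOCALLY UNIFORMLY), the same functional is the constant `φ_∞` on the limit branch.  This file supplies the CLASS-FREE analysis behind it:

* (T0) `contDiffOn_and_tendsto_iteratedFDeriv_of_tendstoLocallyUniformlyOn` — **`C^∞` UPGRADE OF HULL CONVERGENCE, whole sequence**: on an open set `U` of a
  finite-dimensional space, smooth `fₙ` with orderwise common bounds `‖Dⁱ fₙ‖ ≤ Λ_{i,K}` on compacts and `fₙ → g` locally uniformly (VALUES only) ⇒ `g` is smooth on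
  `U` and `Dⁱ fₙ → Dⁱ g` locally uniformly on `U` for EVERY `i`, along the whole sequence (subsequence principle over the tree's `C^∞` Arzelà–Ascoli theorem
  `Literature.Analysis.Calculus.exists_strictMono_contDiffOn_infty_tendstoUniformlyOn_iteratedFDeriv` + uniqueness of the `C⁰` limit); so every finite-order ridge
  functional passes to hull limits once the class supplies the orderwise slice bounds ((F1));
  `continuousOn_iteratedFDeriv_of_contDiffOn` — bookkeeping (`Dⁱ g` is continuous on `U`).
* (T1) translation by convergent vectors — `Fₙ → F` locally uniformly, `F` continuous, `cₙ → c` ⇒ `(x ↦ Fₙ (x + cₙ)) → (x ↦ F (x + c))` locally uniformly —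
  is ns-poloidal-K2-p2 g14's `…PoloidalWindowRigidityHotHullSliding.tendstoLocallyUniformly_comp_add` (LINE 21 H6 helper S4; NOT duplicated here); it identifies
  the hull limit at the shifted base points `γ(s_k + s)` with the translate of the hull limit at `γ(s_k)` by `Γ(s) = lim (γ(s_k+s) − γ(s_k))`; pointwise moving-base-point
  limits are Mathlib's `TendstoLocallyUniformly.tendsto_comp`.
* (T2) `tendsto_iteratedFDeriv_apply` — **jets pass to the limit along converging base points and directions**: `Dⁱ fₙ → Dⁱ g` locally uniformly on open `U`,
  `Dⁱ g` continuous on `U`, `yₙ → y ∈ U`, `mₙ → m` ⇒ `Dⁱ fₙ (yₙ) (mₙ) → Dⁱ g (y) (m)` (hot value, criticality, `θ_νν`, `θ_νz`, `θ_zz` along re-based branch points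
  and their normals).
* (T3) `eq_lim_of_tendsto_shift` — **ABSTRACT HOMOGENISATION**: `φ → L` at `+∞`, `sₙ → +∞`, `Ψₙ a = φ (sₙ + a)` eventually and `Ψₙ a → Ψl a` ⇒ `Ψl a = L` (every `a ∈ ℝ`:
  the limit branch is two-sided); the limit `L` of a bounded quasiconvex `φ` exists by `…TwistingTHRidgeQuasiconvexTools.exists_tendsto_atTop_of_abs_le` (port-2 g4).
* (T4) `exists_tendsto_rebased_curves` — **COMPACTNESS OF RE-BASED BRANCHES** (arclength currency): curves `γₙ : ℝ → E` with `γₙ 0 = 0` and common bounds on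
  `‖γₙ′‖`, `‖γₙ″‖` have a subsequence converging locally uniformly on `ℝ` WITH FIRST DERIVATIVES to a `C¹` curve `Γ`, `Γ 0 = 0` (tree `Cᵏ` Arzelà–Ascoli on `U = univ ⊆ ℝ`);
  `Γ′` `B`-Lipschitz; `norm_eq_of_tendstoLocallyUniformly` — unit speed passes to the limit; `lipschitzWith_of_tendstoLocallyUniformly`.

WHAT THIS IS NOT: not a claim about Navier–Stokes regularity — generic analysis bricks for the (Q3) hull step of a lever on the research stubs `stub_T2b` / `stub_C2a'` /
`stub_C2b'` (bears_on LADDER-NS N0, item 20428 / crux 19708; 20428/19708/27893 OPEN).  No summit statement is proved here; the class-level wiring is the LEAD's.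
-/

noncomputable section

-- the summit and its single sub-problem share the name (CONVENTIONS §1), as in every Theorems file
set_option linter.dupNamespace false

namespace Summit.NavierStokesRegularity.NavierStokesRegularity.Theorems.PoloidalWindowDoorLrcModEntireRidgeHullTools

open Set Filter Topology Metric Function
open scoped ContDiff

section Smooth

variable {E F : Type*} [NormedAddCommGroup E] [NormedSpace ℝ E] [FiniteDimensional ℝ E]
  [NormedAddCommGroup F] [NormedSpace ℝ F] [FiniteDimensional ℝ F]

omit [FiniteDimensional ℝ E] [FiniteDimensional ℝ F] in
/-- Bookkeeping: the derivatives of a map smooth on an open set are continuous there. [folklore] -/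
theorem continuousOn_iteratedFDeriv_of_contDiffOn {U : Set E} (hU : IsOpen U) {g : E → F} (hg : ContDiffOn ℝ ∞ g U) (i : ℕ) :
    ContinuousOn (iteratedFDeriv ℝ i g) U :=
  (hg.continuousOn_iteratedFDerivWithin (m := i) (by exact_mod_cast le_top) hU.uniqueDiffOn).congr
    fun x hx => (iteratedFDerivWithin_of_isOpen (𝕜 := ℝ) (f := g) i hU hx).symm

/-- **(T0) `C^∞` upgrade of locally uniform convergence, whole sequence.**  Let `U` be open in a finite-dimensional space, `fₙ` smooth on `U` with, for every order `i`
and every compact `K ⊆ U`, a common bound `‖Dⁱ fₙ(x)‖ ≤ Λ_{i,K}`, and suppose `fₙ → g` locally uniformly on `U`.  Then `g` is smooth on `U` and, for every `i`,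
`Dⁱ fₙ → Dⁱ g` locally uniformly on `U` (no subsequence).  [folklore] (subsequence principle over the `C^∞` Arzelà–Ascoli theorem, Petersen 2006 Ch. 10 §3.1.) -/
theorem contDiffOn_and_tendsto_iteratedFDeriv_of_tendstoLocallyUniformlyOn {U : Set E} (hU : IsOpen U)
    {f : ℕ → E → F} {g : E → F} (hf : ∀ n, ContDiffOn ℝ ∞ (f n) U)
    (hb : ∀ (i : ℕ), ∀ K ⊆ U, IsCompact K → ∃ Λ : ℝ, ∀ n, ∀ z ∈ K, ‖iteratedFDeriv ℝ i (f n) z‖ ≤ Λ)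
    (hlim : TendstoLocallyUniformlyOn f g atTop U) :
    ContDiffOn ℝ ∞ g U ∧
      ∀ i : ℕ, TendstoLocallyUniformlyOn (fun n => iteratedFDeriv ℝ i (f n)) (iteratedFDeriv ℝ i g) atTop U := by
  -- every subsequence has a further subsequence converging in `C^∞` to a map that agrees with `g` on `U`
  have key : ∀ ψ : ℕ → ℕ, StrictMono ψ → ∃ φ : ℕ → ℕ, StrictMono φ ∧ ContDiffOn ℝ ∞ g U ∧
      ∀ i, ∀ K ⊆ U, IsCompact K →
        TendstoUniformlyOn (fun n => iteratedFDeriv ℝ i (f (ψ (φ n)))) (iteratedFDeriv ℝ i g) atTop K := by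
    intro ψ hψ
    obtain ⟨g', φ, hφ, hg', hlim'⟩ :=
      Literature.Analysis.Calculus.exists_strictMono_contDiffOn_infty_tendstoUniformlyOn_iteratedFDeriv hU
        (f := fun n => f (ψ n)) (fun n => hf (ψ n))
        (fun i K hKU hK => (hb i K hKU hK).imp fun Λ hΛ n z hz => hΛ (ψ n) z hz)
    have hagree : ∀ x ∈ U, g' x = g x := by
      intro x hx
      have t1 : Tendsto (fun n => f (ψ (φ n)) x) atTop (𝓝 (g' x)) :=
        Literature.Analysis.Calculus.tendsto_of_tendstoUniformlyOn_iteratedFDeriv_zero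
          (hlim' 0 {x} (singleton_subset_iff.2 hx) isCompact_singleton)
      have t2 : Tendsto (fun n => f (ψ (φ n)) x) atTop (𝓝 (g x)) :=
        (hlim.tendsto_at hx).comp (hψ.comp hφ).tendsto_atTop
      exact tendsto_nhds_unique t1 t2
    refine ⟨φ, hφ, hg'.congr fun x hx => (hagree x hx).symm, fun i K hKU hK => ?_⟩
    have hder : EqOn (iteratedFDeriv ℝ i g') (iteratedFDeriv ℝ i g) K := fun x hx => by
      refine (Filter.EventuallyEq.iteratedFDeriv ℝ ?_ i).eq_of_nhds
      filter_upwards [hU.mem_nhds (hKU hx)] with y hy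
      exact hagree y hy
    exact (hlim' i K hKU hK).congr_right hder
  obtain ⟨-, -, hg, -⟩ := key id strictMono_id
  refine ⟨hg, fun i => (tendstoLocallyUniformlyOn_iff_forall_isCompact hU).2 fun K hKU hK => ?_⟩
  rw [Metric.tendstoUniformlyOn_iff]
  intro ε hε
  by_contra hcon
  have hfreq : ∃ᶠ n in atTop, ∃ x ∈ K, ε ≤ dist (iteratedFDeriv ℝ i g x) (iteratedFDeriv ℝ i (f n) x) := by
    refine (Filter.not_eventually.1 hcon).mono fun n hn => ?_
    push Not at hn
    exact hn
  obtain ⟨ψ, hψ, hbad⟩ := extraction_of_frequently_atTop hfreq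
  obtain ⟨φ, -, -, hconv⟩ := key ψ hψ
  have h := hconv i K hKU hK
  rw [Metric.tendstoUniformlyOn_iff] at h
  obtain ⟨n, hn⟩ := (h ε hε).exists
  obtain ⟨x, hxK, hx⟩ := hbad (φ n)
  exact absurd (hn x hxK) (not_lt.2 hx)

omit [FiniteDimensional ℝ E] [FiniteDimensional ℝ F] in
/-- **(T2) Jets pass to the limit along converging base points and directions.**  If `Dⁱ fₙ → Dⁱ g` locally uniformly on the open `U`, `Dⁱ g` is continuous on `U`,
`yₙ → y ∈ U` and `mₙ → m`, then `Dⁱ fₙ (yₙ) mₙ → Dⁱ g (y) m`. [folklore] -/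
theorem tendsto_iteratedFDeriv_apply {U : Set E} (hU : IsOpen U) {i : ℕ} {f : ℕ → E → F} {g : E → F}
    (h : TendstoLocallyUniformlyOn (fun n => iteratedFDeriv ℝ i (f n)) (iteratedFDeriv ℝ i g) atTop U)
    (hg : ContinuousOn (iteratedFDeriv ℝ i g) U) {y : ℕ → E} {y₀ : E} (hy₀ : y₀ ∈ U) (hy : Tendsto y atTop (𝓝 y₀))
    {m : ℕ → Fin i → E} {m₀ : Fin i → E} (hm : Tendsto m atTop (𝓝 m₀)) :
    Tendsto (fun n => iteratedFDeriv ℝ i (f n) (y n) (m n)) atTop (𝓝 (iteratedFDeriv ℝ i g y₀ m₀)) := by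
  have hyU : Tendsto y atTop (𝓝[U] y₀) :=
    tendsto_nhdsWithin_of_tendsto_nhds_of_eventually_within _ hy (hy.eventually (hU.mem_nhds hy₀))
  have hL : Tendsto (fun n => iteratedFDeriv ℝ i (f n) (y n)) atTop (𝓝 (iteratedFDeriv ℝ i g y₀)) :=
    h.tendsto_comp (hg.continuousWithinAt hy₀) hy₀ hyU
  have hev : Continuous fun p : (E [×i]→L[ℝ] F) × (Fin i → E) => p.1 p.2 := continuous_eval
  exact (hev.tendsto (iteratedFDeriv ℝ i g y₀, m₀)).comp (hL.prodMk_nhds hm)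

end Smooth

/-! ### (T3) Abstract homogenisation -/

section Homogenisation

variable {Y : Type*} [TopologicalSpace Y] [T2Space Y]

/-- **(T3) Abstract homogenisation.**  If `φ → L` at `+∞`, `sₙ → +∞`, and the re-based functionals `Ψₙ` satisfy `Ψₙ a = φ (sₙ + a)` eventually and converge,
`Ψₙ a → Ψl a`, then `Ψl a = L`.  (Every `a ∈ ℝ`: the re-based branches `γ(sₙ + ·)` are defined on `[−sₙ, ∞) ↑ ℝ`, so the limit branch is two-sided and the
functional is constant on all of it.) [folklore] -/
theorem eq_lim_of_tendsto_shift {φ : ℝ → Y} {L : Y} (hφ : Tendsto φ atTop (𝓝 L)) {s : ℕ → ℝ} (hs : Tendsto s atTop atTop)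
    {Ψ : ℕ → ℝ → Y} {Ψl : ℝ → Y} {a : ℝ} (heq : ∀ᶠ n in atTop, Ψ n a = φ (s n + a))
    (hlim : Tendsto (fun n => Ψ n a) atTop (𝓝 (Ψl a))) : Ψl a = L := by
  have h1 : Tendsto (fun n => φ (s n + a)) atTop (𝓝 L) := hφ.comp (tendsto_atTop_add_const_right _ a hs)
  have h2 : Tendsto (fun n => Ψ n a) atTop (𝓝 L) := h1.congr' (heq.mono fun n hn => hn.symm)
  exact tendsto_nhds_unique hlim h2

/-- (T3), eventual form of the hypothesis: it suffices that `Ψₙ a = φ (sₙ + a)` whenever `0 ≤ sₙ + a` (the re-based branch point `sₙ + a` lies on the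
original half-branch `[0, ∞)`). [folklore] -/
theorem eq_lim_of_tendsto_shift' {φ : ℝ → Y} {L : Y} (hφ : Tendsto φ atTop (𝓝 L)) {s : ℕ → ℝ} (hs : Tendsto s atTop atTop)
    {Ψ : ℕ → ℝ → Y} {Ψl : ℝ → Y} {a : ℝ} (heq : ∀ n, 0 ≤ s n + a → Ψ n a = φ (s n + a))
    (hlim : Tendsto (fun n => Ψ n a) atTop (𝓝 (Ψl a))) : Ψl a = L :=
  eq_lim_of_tendsto_shift hφ hs (((tendsto_atTop_add_const_right _ a hs).eventually_ge_atTop 0).mono fun n hn => heq n hn) hlim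

end Homogenisation

/-! ### (T4) Compactness of re-based branches (arclength currency) -/

section Curves

variable {V : Type*} [NormedAddCommGroup V] [NormedSpace ℝ V] [FiniteDimensional ℝ V]

omit [NormedSpace ℝ V] [FiniteDimensional ℝ V] in
/-- A pointwise constant norm passes to locally uniform limits: `‖Fₙ x‖ = c` for all `n, x` and `Fₙ → f` locally uniformly ⇒ `‖f x‖ = c`
(unit speed of re-based arclength branches survives in the limit). [folklore] -/
theorem norm_eq_of_tendstoLocallyUniformly {X : Type*} [TopologicalSpace X] {F : ℕ → X → V} {f : X → V}
    (hF : TendstoLocallyUniformly F f atTop) {c : ℝ} (hc : ∀ n x, ‖F n x‖ = c) (x : X) : ‖f x‖ = c := by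
  have h1 : Tendsto (fun n => ‖F n x‖) atTop (𝓝 ‖f x‖) :=
    (continuous_norm.tendsto _).comp ((tendstoLocallyUniformlyOn_univ.2 hF).tendsto_at (mem_univ x))
  have h2 : (fun n => ‖F n x‖) = fun _ => c := funext fun n => hc n x
  rw [h2] at h1
  exact tendsto_nhds_unique h1 tendsto_const_nhds

omit [NormedSpace ℝ V] [FiniteDimensional ℝ V] in
/-- A common Lipschitz constant passes to locally uniform (indeed pointwise) limits. [folklore] -/
theorem lipschitzWith_of_tendstoLocallyUniformly {X : Type*} [PseudoMetricSpace X] {F : ℕ → X → V} {f : X → V}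
    (hF : TendstoLocallyUniformly F f atTop) {K : NNReal} (hL : ∀ n, LipschitzWith K (F n)) : LipschitzWith K f := by
  refine LipschitzWith.of_dist_le_mul fun x y => ?_
  have hx := (tendstoLocallyUniformlyOn_univ.2 hF).tendsto_at (mem_univ x)
  have hy := (tendstoLocallyUniformlyOn_univ.2 hF).tendsto_at (mem_univ y)
  exact le_of_tendsto (hx.dist hy) (Eventually.of_forall fun n => (hL n).dist_le_mul x y)

/-- **(T4) COMPACTNESS OF RE-BASED BRANCHES.**  Let `γₙ : ℝ → V` (`V` finite-dimensional) be `C²` curves with `γₙ 0 = 0`, speed `‖γₙ′‖ ≤ L` and curvature bound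
`‖γₙ″‖ ≤ B` (`iteratedDeriv 2`).  Then a subsequence converges LOCALLY UNIFORMLY ON `ℝ` TOGETHER WITH FIRST DERIVATIVES to a `C¹` curve `Γ` with `Γ 0 = 0`, and
`Γ′` is `B`-Lipschitz (tree `Cᵏ` Arzelà–Ascoli `Literature.Analysis.Calculus.exists_strictMono_contDiffOn_tendstoLocallyUniformlyOn_iteratedFDeriv` on `U = univ ⊆ ℝ`).
Model: `γₙ s = γ (sₙ + s) − γ sₙ` for an arclength-parametrised hot branch `γ` with bounded curvature.  [folklore] (Petersen 2006 Ch. 10 §3.1.) -/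
theorem exists_tendsto_rebased_curves {γ : ℕ → ℝ → V} (hγ : ∀ n, ContDiff ℝ 2 (γ n)) (h0 : ∀ n, γ n 0 = 0) {L B : ℝ}
    (hL : ∀ n s, ‖deriv (γ n) s‖ ≤ L) (hB : ∀ n s, ‖iteratedDeriv 2 (γ n) s‖ ≤ B) :
    ∃ (Γ : ℝ → V) (φ : ℕ → ℕ), StrictMono φ ∧ ContDiff ℝ 1 Γ ∧ Γ 0 = 0 ∧
      TendstoLocallyUniformly (fun n => γ (φ n)) Γ atTop ∧
      TendstoLocallyUniformly (fun n => deriv (γ (φ n))) (deriv Γ) atTop ∧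
      LipschitzWith (Real.toNNReal B) (deriv Γ) := by
  have hdiff : ∀ n, Differentiable ℝ (γ n) := fun n => (hγ n).differentiable (by norm_num)
  have hf : ∀ n, ContDiffOn ℝ ((1 : ℕ) + 1) (γ n) univ := fun n =>
    (hγ n).contDiffOn.of_le (by norm_num)
  -- common bounds on `[−R, R]`-type compacts: order 0 by the mean value inequality from `γₙ 0 = 0`
  have hb : ∀ K ⊆ (univ : Set ℝ), IsCompact K →
      ∃ Λ : ℝ, ∀ n, ∀ i, i ≤ 1 + 1 → ∀ z ∈ K, ‖iteratedFDeriv ℝ i (γ n) z‖ ≤ Λ := by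
    intro K _ hK
    obtain ⟨R, hR⟩ := (isBounded_iff_subset_closedBall (0 : ℝ)).1 hK.isBounded
    refine ⟨max (L * |R|) (max L B), fun n i hi z hz => ?_⟩
    rw [norm_iteratedFDeriv_eq_norm_iteratedDeriv]
    have hz' : ‖z‖ ≤ |R| := by
      have : dist z 0 ≤ R := hR hz
      rw [dist_zero_right] at this
      exact this.trans (le_abs_self R)
    interval_cases i
    · rw [iteratedDeriv_zero]
      have hmv : ‖γ n z - γ n 0‖ ≤ L * ‖z - 0‖ :=
        (convex_univ).norm_image_sub_le_of_norm_deriv_le (fun x _ => (hdiff n) x) (fun x _ => hL n x) (mem_univ _) (mem_univ _)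
      rw [h0 n, sub_zero, sub_zero] at hmv
      have hL0 : 0 ≤ L := (norm_nonneg _).trans (hL n 0)
      exact (hmv.trans (mul_le_mul_of_nonneg_left hz' hL0)).trans (le_max_left _ _)
    · rw [iteratedDeriv_one]
      exact (hL n z).trans ((le_max_left _ _).trans (le_max_right _ _))
    · exact (hB n z).trans ((le_max_right _ _).trans (le_max_right _ _))
  obtain ⟨g, φ, hφ, hg, hlim⟩ :=
    Literature.Analysis.Calculus.exists_strictMono_contDiffOn_tendstoLocallyUniformlyOn_iteratedFDeriv isOpen_univ hf hb
  -- back to `iteratedDeriv` currency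
  have hconv : ∀ i, i ≤ 1 → TendstoLocallyUniformly (fun n => iteratedDeriv i (γ (φ n))) (iteratedDeriv i g) atTop := by
    intro i hi
    have h1 := (hlim i hi).congr_right (iteratedFDerivWithin_of_isOpen (𝕜 := ℝ) (f := g) i isOpen_univ)
    rw [tendstoLocallyUniformlyOn_univ] at h1
    have h2 := (ContinuousMultilinearMap.piFieldEquiv ℝ (Fin i) V).symm.isometry.uniformContinuous.comp_tendstoLocallyUniformly h1
    simp_rw [← iteratedDeriv_eq_equiv_comp] at h2
    exact h2
  have hc0 : TendstoLocallyUniformly (fun n => γ (φ n)) g atTop := by simpa using hconv 0 zero_le_one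
  have hc1 : TendstoLocallyUniformly (fun n => deriv (γ (φ n))) (deriv g) atTop := by simpa using hconv 1 le_rfl
  have hg1 : ContDiff ℝ 1 g := by
    have := contDiffOn_univ.1 hg
    simpa using this
  have hg0 : g 0 = 0 := by
    have h := hc0.tendsto_comp hg1.continuous.continuousAt (tendsto_const_nhds (x := (0 : ℝ)))
    have e : (fun n => γ (φ n) 0) = fun _ => (0 : V) := funext fun n => h0 (φ n)
    rw [e] at h
    exact tendsto_nhds_unique h tendsto_const_nhds
  -- the curvature bound makes every `γₙ′` `B`-Lipschitz, and this passes to the limit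
  have hLip : ∀ n, LipschitzWith (Real.toNNReal B) (deriv (γ (φ n))) := fun n => by
    refine LipschitzWith.of_dist_le_mul fun x y => ?_
    have hd2 : Differentiable ℝ (deriv (γ (φ n))) := (hγ (φ n)).differentiable_deriv_two
    have hmv : ‖deriv (γ (φ n)) x - deriv (γ (φ n)) y‖ ≤ B * ‖x - y‖ :=
      (convex_univ).norm_image_sub_le_of_norm_deriv_le (fun z _ => hd2 z) (fun z _ => by
        have := hB (φ n) z
        rwa [iteratedDeriv_succ, iteratedDeriv_one] at this) (mem_univ _) (mem_univ _)
    rw [dist_eq_norm, dist_eq_norm]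
    exact hmv.trans (mul_le_mul_of_nonneg_right (Real.le_coe_toNNReal B) (norm_nonneg _))
  exact ⟨g, φ, hφ, hg1, hg0, hc0, hc1, lipschitzWith_of_tendstoLocallyUniformly hc1 hLip⟩

end Curves

end Summit.NavierStokesRegularity.NavierStokesRegularity.Theorems.PoloidalWindowDoorLrcModEntireRidgeHullTools

end
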